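import Summits.CriticalPhenomena.PercolationContinuityZ3.Theorems.PercNearOneGluingNoHeavyLowerTailSahiCTCSignature

/-!
# `NoHeavyLowerTail` (crux stmt-CriticalPhenomena-4575), P3 lane: the TYPE SUM of `Π·(Π·e_c − Θ_{c−1}·D_c)` — the coefficient of the
# row-(a) Pólya polynomial at a profile depends only on its type `(a₁, a₂, a₃)`

Support file (cell `prim-l12`, seat P3, gen 22; `--supports stmt-CriticalPhenomena-4575`).  No `sorry`, no named facts, standard
axioms, no new definitions.  Memo `run/shared/lean/prim/prim-l12/FROM-prim-l12-p3-g22-*.md`; g21 memo §8 (the type formulas `pos − neg`).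

With `X_c := Π·e_c − Θ_{c−1}·D_c` and its signature values `B_c(w,d) = sigB c w d` (`…SahiCTCSignature.coeff_PiE_sub_ThD`), the
coefficient of `Π·X_c` at a profile `n` is `Σ_{P ⊆ supp n} B_c(signature of n − 1_P)` (`coeff_gf_mul`).  THIS FILE evaluates that sum:

* `signature_tsub_ind_three` : for `n ≤ 3` pointwise and `P ⊇ V₃ = {n = 3}`, the sub-profile `n − 1_P` has entries `≤ 2`,
  `#doubled = a₃ + #(V₂ ∖ P)` and `#single = #(V₁ ∖ P) + #(V₂ ∩ P)` (`V_j = {n = j}`, `a_j = #V_j`); if `V₃ ⊄ P` it has an entry `3`;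
* `sum_between_eq_typeSum` : `Σ_{V₃ ⊆ P ⊆ V₁∪V₂∪V₃} F(#(V₁∖P), #(V₂∖P)) = Σ_b Σ_d C(a₁,b)·C(a₂,d)·F(b,d)` (bijection with
  `V₁.powerset × V₂.powerset`, `Finset.sum_powerset_apply_card` twice);
* `coeff_PiP_mul_X_eq_typeSum` : **for `n ≤ 3` pointwise, `[n](Π·X_{c'+1}) = Σ_{b ≤ a₁} Σ_{d ≤ a₂} C(a₁,b)·C(a₂,d)·B_{c'+1}(a₂ − d + b, a₃ + d)`**;
  `coeff_PiP_mul_X_eq_zero` : it vanishes if some `n i ≥ 4`;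
* `sigB_succ_succ` : the level shift `B_{c+1}(w, d+1) = B_c(w, d)`.
The companions `…SahiAllButThreeRowA` / `…SahiAllButFourRowA` prove `Π·X₃, Π·X₄ ∈ ℕ[r]` from these.  Nothing is asserted about the crux.
-/

noncomputable section

open scoped Classical

namespace Summit.CriticalPhenomena.PercolationContinuityZ3.Theorems

namespace SahiAllButC

open Finset MvPolynomial
open SahiCTCForms SahiCTCGenFun SahiCTCWeightedLYM

/-! ### Profiles with entries `≤ 3`: levels, sub-profiles through the tripled points, and the TYPE SUM -/

section TypeSum

variable {α : Type*} [DecidableEq α] [Fintype α]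

omit [Fintype α] in
/-- **The signature of a sub-profile `n − 1_P` for `n ≤ 3` pointwise and `P ⊇ V₃`** (the tripled points): entries `≤ 2`,
`#doubled = #V₃ + #(V₂ ∖ P)`, `#single = #(V₁ ∖ P) + #(V₂ ∩ P)` (`V_j = {i : n i = j}`). [this work] -/
theorem signature_tsub_ind_three {n : α →₀ ℕ} (hn : ∀ i, n i ≤ 3) {P : Finset α}
    (hP : (n.support.filter fun i => n i = 3) ⊆ P) :
    (∀ i, (n - ind P) i ≤ 2) ∧
      #(dbl (n - ind P)) = #(n.support.filter fun i => n i = 3) + #(dbl n \ P) ∧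
      #(n - ind P).support - #(dbl (n - ind P)) = #((n.support.filter fun i => n i = 1) \ P) + #(dbl n ∩ P) := by
  have hv : ∀ i, (n - ind P) i = n i - if i ∈ P then 1 else 0 := tsub_ind_apply n P
  have h4 : ∀ i, n i = 0 ∨ n i = 1 ∨ n i = 2 ∨ n i = 3 := fun i => by have := hn i; omega
  have hP' : ∀ i, n i = 3 → i ∈ P := fun i hi => hP (mem_filter.2 ⟨Finsupp.mem_support_iff.2 (by omega), hi⟩)
  -- pointwise case analysis: `n i ∈ {0,1,2,3}`, `i ∈ P` or not (`n i = 3` forces `i ∈ P`)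
  have key : ∀ (p : Prop) (i : α), (∀ k, n i = k → k ≤ 3 → (i ∈ P ∨ k ≠ 3) → p) → p := by
    intro p i h
    rcases h4 i with hk | hk | hk | hk
    · exact h 0 hk (by norm_num) (Or.inr (by norm_num))
    · exact h 1 hk (by norm_num) (Or.inr (by norm_num))
    · exact h 2 hk (by norm_num) (Or.inr (by norm_num))
    · exact h 3 hk le_rfl (Or.inl (hP' i hk))
  have hdbl : dbl (n - ind P) = (n.support.filter fun i => n i = 3) ∪ (dbl n \ P) := by
    ext i
    simp only [dbl, mem_filter, Finsupp.mem_support_iff, mem_sdiff, mem_union, hv]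
    by_cases hi : i ∈ P
    · rcases h4 i with h | h | h | h <;> simp [h, hi]
    · have h3 : n i ≠ 3 := fun h => hi (hP' i h)
      rcases h4 i with h | h | h | h
      · simp [h, hi]
      · simp [h, hi]
      · simp [h, hi]
      · exact absurd h h3
  have hsupp : (n - ind P).support =
      ((n.support.filter fun i => n i = 3) ∪ dbl n) ∪ ((n.support.filter fun i => n i = 1) \ P) := by
    ext i
    simp only [dbl, mem_filter, Finsupp.mem_support_iff, mem_sdiff, mem_union, hv]
    by_cases hi : i ∈ P
    · rcases h4 i with h | h | h | h <;> simp [h, hi]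
    · have h3 : n i ≠ 3 := fun h => hi (hP' i h)
      rcases h4 i with h | h | h | h
      · simp [h, hi]
      · simp [h, hi]
      · simp [h, hi]
      · exact absurd h h3
  have hle : ∀ i, (n - ind P) i ≤ 2 := by
    intro i
    rw [hv]
    by_cases hi : i ∈ P
    · rw [if_pos hi]; have := hn i; omega
    · rw [if_neg hi]; have h3 : n i ≠ 3 := fun h => hi (hP' i h); have := hn i; omega
  have hd32 : Disjoint (n.support.filter fun i => n i = 3) (dbl n) :=
    disjoint_left.2 fun i h1 h2 => by
      have := (mem_filter.1 h1).2; have := (mem_filter.1 h2).2; omega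
  have hd3P : Disjoint (n.support.filter fun i => n i = 3) (dbl n \ P) := hd32.mono_right sdiff_subset
  have hd1 : Disjoint ((n.support.filter fun i => n i = 3) ∪ dbl n) ((n.support.filter fun i => n i = 1) \ P) :=
    disjoint_left.2 fun i h1 h2 => by
      have h1' := (mem_filter.1 (mem_sdiff.1 h2).1).2
      rcases mem_union.1 h1 with h | h
      · have := (mem_filter.1 h).2; omega
      · have := (mem_filter.1 h).2; omega
  refine ⟨hle, by rw [hdbl, card_union_of_disjoint hd3P], ?_⟩
  rw [hdbl, hsupp, card_union_of_disjoint hd1, card_union_of_disjoint hd32, card_union_of_disjoint hd3P]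
  have h1 := card_sdiff_add_card_inter (dbl n) P
  omega

omit [Fintype α] in
/-- If `n i ≥ 3` at a point outside `P`, the sub-profile `n − 1_P` has an entry `≥ 3`. [this work] -/
theorem not_le_two_of_three_notMem {n : α →₀ ℕ} {P : Finset α} {t : α} (ht : 3 ≤ n t) (htP : t ∉ P) :
    ¬ ∀ i, (n - ind P) i ≤ 2 := by
  intro h
  have := h t
  rw [tsub_ind_apply, if_neg htP] at this
  omega

/-- `range` sums of an integer-valued function agree if it vanishes beyond both bounds. [folklore] -/
theorem sum_range_eq_of_vanish_int {F : ℕ → ℤ} {a b : ℕ} (ha : ∀ i, a ≤ i → F i = 0) (hb : ∀ i, b ≤ i → F i = 0) :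
    ∑ i ∈ range a, F i = ∑ i ∈ range b, F i := by
  have key : ∀ {x y : ℕ}, (∀ i, x ≤ i → F i = 0) → x ≤ y → ∑ i ∈ range x, F i = ∑ i ∈ range y, F i :=
    fun hx hxy => sum_subset (range_subset_range.2 hxy) fun i _ hi' => hx i (by rw [mem_range, not_lt] at hi'; exact hi')
  rcases le_total a b with h | h
  · exact key ha h
  · exact (key hb h).symm

omit [Fintype α] in
/-- **Subsets between `V₃` and `supp n` ↔ pairs (complement in `V₁`, complement in `V₂`)**: a double `powerset` sum.
For pairwise disjoint `V₁, V₂, V₃` and any `F`,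
`Σ_{V₃ ⊆ P ⊆ V₁ ∪ V₂ ∪ V₃} F(#(V₁ ∖ P), #(V₂ ∖ P)) = Σ_b Σ_d C(#V₁, b)·C(#V₂, d)·F(b, d)`. [this work] -/
theorem sum_between_eq_typeSum (V₁ V₂ V₃ : Finset α) (h12 : Disjoint V₁ V₂) (h13 : Disjoint V₁ V₃) (h23 : Disjoint V₂ V₃)
    (F : ℕ → ℕ → ℤ) :
    ∑ P ∈ (V₁ ∪ V₂ ∪ V₃).powerset.filter (fun P => V₃ ⊆ P), F #(V₁ \ P) #(V₂ \ P) =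
      ∑ b ∈ range (#V₁ + 1), ∑ d ∈ range (#V₂ + 1), ((#V₁).choose b : ℤ) * ((#V₂).choose d : ℤ) * F b d := by
  -- reindex by `P ↦ (V₁ \ P, V₂ \ P)`, inverse `(B, D) ↦ (V₁ ∪ V₂ ∪ V₃) \ (B ∪ D)`
  have step1 : ∑ P ∈ (V₁ ∪ V₂ ∪ V₃).powerset.filter (fun P => V₃ ⊆ P), F #(V₁ \ P) #(V₂ \ P) =
      ∑ BD ∈ V₁.powerset ×ˢ V₂.powerset, F #BD.1 #BD.2 := by
    refine sum_nbij' (fun P => (V₁ \ P, V₂ \ P)) (fun BD => (V₁ ∪ V₂ ∪ V₃) \ (BD.1 ∪ BD.2)) (fun P hP => ?_)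
      (fun BD hBD => ?_) (fun P hP => ?_) (fun BD hBD => ?_) (fun P hP => rfl)
    · exact mem_coe.2 (mem_product.2 ⟨mem_powerset.2 sdiff_subset, mem_powerset.2 sdiff_subset⟩)
    · obtain ⟨hB, hD⟩ := mem_product.1 (mem_coe.1 hBD)
      rw [mem_powerset] at hB hD
      refine mem_coe.2 (mem_filter.2 ⟨mem_powerset.2 sdiff_subset, fun x hx => mem_sdiff.2 ⟨?_, fun hx' => ?_⟩⟩)
      · exact mem_union_right _ hx
      · rcases mem_union.1 hx' with h | h
        · exact disjoint_left.1 h13 (hB h) hx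
        · exact disjoint_left.1 h23 (hD h) hx
    · obtain ⟨hPU, hP3⟩ := mem_filter.1 (mem_coe.1 hP)
      rw [mem_powerset] at hPU
      show (V₁ ∪ V₂ ∪ V₃) \ ((V₁ \ P) ∪ (V₂ \ P)) = P
      ext x
      simp only [mem_sdiff, mem_union]
      constructor
      · rintro ⟨hxU, hx⟩
        by_contra hxP
        rcases hxU with (h | h) | h
        · exact hx (Or.inl ⟨h, hxP⟩)
        · exact hx (Or.inr ⟨h, hxP⟩)
        · exact hxP (hP3 h)
      · intro hxP
        refine ⟨?_, ?_⟩
        · have := hPU hxP; simpa only [mem_union] using this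
        · rintro (⟨-, h⟩ | ⟨-, h⟩) <;> exact h hxP
    · obtain ⟨hB, hD⟩ := mem_product.1 (mem_coe.1 hBD)
      rw [mem_powerset] at hB hD
      refine Prod.ext ?_ ?_
      · show V₁ \ ((V₁ ∪ V₂ ∪ V₃) \ (BD.1 ∪ BD.2)) = BD.1
        ext x
        simp only [mem_sdiff, mem_union, not_and, not_not]
        constructor
        · rintro ⟨hx1, hx⟩
          rcases hx (Or.inl (Or.inl hx1)) with h | h
          · exact h
          · exact absurd hx1 (disjoint_right.1 h12 (hD h))
        · intro hx
          exact ⟨hB hx, fun _ => Or.inl hx⟩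
      · show V₂ \ ((V₁ ∪ V₂ ∪ V₃) \ (BD.1 ∪ BD.2)) = BD.2
        ext x
        simp only [mem_sdiff, mem_union, not_and, not_not]
        constructor
        · rintro ⟨hx2, hx⟩
          rcases hx (Or.inl (Or.inr hx2)) with h | h
          · exact absurd hx2 (disjoint_left.1 h12 (hB h))
          · exact h
        · intro hx
          exact ⟨hD hx, fun _ => Or.inr hx⟩
  rw [step1, sum_product]
  -- inner and outer `powerset` sums by cardinality
  have inner : ∀ B ∈ V₁.powerset, ∑ D ∈ V₂.powerset, F #B #D = ∑ d ∈ range (#V₂ + 1), ((#V₂).choose d : ℤ) * F #B d := by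
    intro B _
    rw [sum_powerset_apply_card (fun d => F #B d)]
    exact sum_congr rfl fun d _ => by rw [nsmul_eq_mul]
  rw [sum_congr rfl inner, sum_powerset_apply_card (fun b => ∑ d ∈ range (#V₂ + 1), ((#V₂).choose d : ℤ) * F b d)]
  refine sum_congr rfl fun b _ => ?_
  rw [nsmul_eq_mul, mul_sum]
  exact sum_congr rfl fun d _ => by ring

/-- **THE TYPE SUM.**  For a profile `n ≤ 3` pointwise with `a_j = #{i : n i = j}` (`a₂ = #dbl n`), the coefficient of
`Π·(Π·e_{c'+1} − Θ_{c'}·D_{c'+1})` at `n` is `Σ_{b ≤ a₁} Σ_{d ≤ a₂} C(a₁,b)·C(a₂,d)·B_{c'+1}(a₂ − d + b, a₃ + d)` — it depends on the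
TYPE `(a₁, a₂, a₃)` only (memo g21 §8's `pos − neg`). [this work] -/
theorem coeff_PiP_mul_X_eq_typeSum (c' : ℕ) {n : α →₀ ℕ} (hn : ∀ i, n i ≤ 3) :
    (PiP * (PiP * ee (c' + 1) - ThC c' * DdC (c' + 1)) : MvPolynomial α ℤ).coeff n =
      ∑ b ∈ range (#(n.support.filter fun i => n i = 1) + 1), ∑ d ∈ range (#(dbl n) + 1),
        ((#(n.support.filter fun i => n i = 1)).choose b : ℤ) * ((#(dbl n)).choose d : ℤ) *
          sigB (c' + 1) (#(dbl n) - d + b) (#(n.support.filter fun i => n i = 3) + d) := by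
  set V₁ := n.support.filter (fun i => n i = 1) with hV₁
  set V₂ := dbl n with hV₂
  set V₃ := n.support.filter (fun i => n i = 3) with hV₃
  set X := (PiP * ee (c' + 1) - ThC c' * DdC (c' + 1) : MvPolynomial α ℤ) with hX
  rw [show (PiP : MvPolynomial α ℤ) = gf univ.powerset from rfl, coeff_gf_mul]
  have h12 : Disjoint V₁ V₂ := disjoint_left.2 fun i h1 h2 => by
    have := (mem_filter.1 h1).2; have := (mem_filter.1 h2).2; omega
  have h13 : Disjoint V₁ V₃ := disjoint_left.2 fun i h1 h2 => by
    have := (mem_filter.1 h1).2; have := (mem_filter.1 h2).2; omega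
  have h23 : Disjoint V₂ V₃ := disjoint_left.2 fun i h1 h2 => by
    have := (mem_filter.1 h1).2; have := (mem_filter.1 h2).2; omega
  have hU : V₁ ∪ V₂ ∪ V₃ = n.support := by
    ext i
    simp only [hV₁, hV₂, hV₃, dbl, mem_union, mem_filter, Finsupp.mem_support_iff]
    have := hn i
    constructor
    · rintro ((⟨h, -⟩ | ⟨h, -⟩) | ⟨h, -⟩) <;> exact h
    · intro h; omega
  -- the index set `{P : 1_P ≤ n}` is `(supp n).powerset`; terms with `V₃ ⊄ P` vanish
  have hS : (univ.powerset : Finset (Finset α)).filter (fun P => ind P ≤ n) = (V₁ ∪ V₂ ∪ V₃).powerset := by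
    ext P
    simp only [mem_filter, mem_powerset, hU, ind_le_iff_subset_support, subset_univ, true_and]
  rw [hS, ← sum_filter_add_sum_filter_not _ (fun P => V₃ ⊆ P)]
  have hzero : ∑ P ∈ (V₁ ∪ V₂ ∪ V₃).powerset.filter (fun P => ¬ V₃ ⊆ P), X.coeff (n - ind P) = 0 := by
    refine sum_eq_zero fun P hP => ?_
    obtain ⟨-, hP3⟩ := mem_filter.1 hP
    obtain ⟨t, ht3, htP⟩ := not_subset.1 hP3
    have ht : 3 ≤ n t := by have := (mem_filter.1 ht3).2; omega
    rw [hX, coeff_PiE_sub_ThD, if_neg (not_le_two_of_three_notMem ht htP)]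
  rw [hzero, add_zero]
  -- on the remaining terms the coefficient is the signature value
  have hval : ∀ P ∈ (V₁ ∪ V₂ ∪ V₃).powerset.filter (fun P => V₃ ⊆ P),
      X.coeff (n - ind P) = sigB (c' + 1) (#V₂ - #(V₂ \ P) + #(V₁ \ P)) (#V₃ + #(V₂ \ P)) := by
    intro P hP
    obtain ⟨-, hP3⟩ := mem_filter.1 hP
    obtain ⟨h2, hd, hw⟩ := signature_tsub_ind_three hn hP3
    rw [hX, coeff_PiE_sub_ThD, if_pos h2, hw, hd]
    have h1 := card_sdiff_add_card_inter V₂ P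
    rw [show #V₂ - #(V₂ \ P) + #(V₁ \ P) = #(V₁ \ P) + #(V₂ ∩ P) by omega]
  rw [sum_congr rfl hval, sum_between_eq_typeSum V₁ V₂ V₃ h12 h13 h23 (fun b d => sigB (c' + 1) (#V₂ - d + b) (#V₃ + d))]

/-- If some entry of `n` is `≥ 4`, the coefficient of `Π·X_c` at `n` vanishes (all three factors are multilinear). [this work] -/
theorem coeff_PiP_mul_X_eq_zero (c' : ℕ) {n : α →₀ ℕ} {t : α} (ht : 4 ≤ n t) :
    (PiP * (PiP * ee (c' + 1) - ThC c' * DdC (c' + 1)) : MvPolynomial α ℤ).coeff n = 0 := by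
  set X := (PiP * ee (c' + 1) - ThC c' * DdC (c' + 1) : MvPolynomial α ℤ) with hX
  rw [show (PiP : MvPolynomial α ℤ) = gf univ.powerset from rfl, coeff_gf_mul]
  refine sum_eq_zero fun P _ => ?_
  rw [hX, coeff_PiE_sub_ThD, if_neg]
  intro h
  have := h t
  rw [tsub_ind_apply] at this
  split_ifs at this <;> omega

/-- **The level shift**: `B_{c+1}(w, d+1) = B_c(w, d)` (a doubled point common to `Q` and `R` lowers the level by one). [this work] -/
theorem sigB_succ_succ (c w d : ℕ) : sigB (c + 1) w (d + 1) = sigB c w d := by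
  unfold sigB posN negN
  rw [show c + 1 - (d + 1) = c - d by omega]
  congr 1
  · simp only [Nat.succ_le_succ_iff]
  · push_cast
    refine sum_congr rfl fun i _ => ?_
    by_cases h : c < d + (w - i)
    · rw [if_pos h, if_pos (by omega)]
    · rw [if_neg h, if_neg (by omega)]

end TypeSum

end SahiAllButC

end Summit.CriticalPhenomena.PercolationContinuityZ3.Theorems
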